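import Summits.BirchSwinnertonDyer.Rank1Residual.X11b.KummerTwistIntersectionPadic
import Summits.BirchSwinnertonDyer.Rank1Residual.X11b.UnrIntegersTeichmuller
import Mathlib.RingTheory.RootsOfUnity.AlgebraicallyClosed
import Mathlib.Analysis.Normed.Group.Ultra
import HarnessLib

/-!
# Deep-layer rigidity in `R₀⟦T⟧`: a series whose values at the points `aζ − 1` (`ζ` of order `3ⁿ`, `n` large) are
# divisible by `3` has positive `μ`-invariant

Support analysis for the crux `SigmaCongruenceAtThree` (stmt-BirchSwinnertonDyer-27120), crux idea `deep-conductor-stability`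
(`Cruxes/SigmaCongruenceAtThree/Ideas/deep-conductor-stability.md`, First lemma `DeepLayerRigidity`): for `H ∈ R₀⟦T⟧`
(`R₀ = unrIntegers 3 ⊂ ℂ_3`), `a ∈ ℂ_3` with `‖a − 1‖ < 1`, if for all `n ≥ n₀` and all primitive `3ⁿ`-th roots of unity `ζ`
the value `H(aζ − 1)` has norm `≤ ‖3‖`, then EVERY coefficient of `H` has norm `< 1` (`μ(H) ≥ 1`). This is the last step of the
card's mechanism («two frames congruent at deep conductor ⇒ congruent mod 3»). Proof (no Weierstrass preparation): if some
coefficient is a unit, let `λ` be the first; at `x = aζ − 1` with `‖ζ − 1‖ = 3^{-1/φ(3ⁿ)}` close enough to `1` the term `H_λ x^λ` has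
norm `‖x‖^λ > 1/3` and STRICTLY dominates all others (`‖H_i‖ ≤ 1/3` for `i < λ` since `R₀` is a DVR with uniformiser `3`;
`‖x‖^i ≤ ‖x‖^{λ+1}` for `i > λ`), so `‖H(x)‖ = ‖x‖^λ > ‖3‖` by the ultrametric inequality — contradiction.

Also: `norm_sub_one_pow_totient_of_isPrimitiveRoot_prime_pow` (`‖ζ − 1‖^{φ(pⁿ)} = p⁻¹` for a primitive `pⁿ`-th root of unity in
`ℂ_p`, any prime `p`, `n ≥ 1`; from `Φ_{pⁿ}(1) = p`). THEOREMS ONLY; no `sorry`; Mathlib + route-independent tree files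
(`X11b.R1.*` norms of roots of unity, `R1.norm_le_inv_of_norm_lt_one`). References: Washington, GTM 83, §7.2; Cassels, *Local Fields*,
Ch. 6; folklore.
-/

noncomputable section

open scoped Classical

set_option linter.dupNamespace false
set_option autoImplicit false

namespace Summit.BirchSwinnertonDyer.BirchSwinnertonDyer.Theorems.UniversalToricDescentDeepLayerRigidity

open Polynomial Literature.NumberTheory.EllipticCurves Summit.BirchSwinnertonDyer.Rank1Residual.X11b

/-! ## §1 `‖ζ − 1‖^{φ(pⁿ)} = p⁻¹` -/

section RootNorm

variable {p : ℕ} [hp : Fact p.Prime]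

/-- **`‖ζ − 1‖^{φ(pⁿ)} = p⁻¹`** for a primitive `pⁿ`-th root of unity `ζ ∈ ℂ_p`, `n ≥ 1`: `p = Φ_{pⁿ}(1) = ∏_{μ primitive} (1 − μ)`
and all `φ(pⁿ)` factors have the same norm (`R1.norm_one_sub_pow_eq`). [folklore] -/
theorem norm_sub_one_pow_totient_of_isPrimitiveRoot_prime_pow {n : ℕ} (hn : 0 < n) {ζ : ℂ_[p]}
    (hζ : IsPrimitiveRoot ζ (p ^ n)) : ‖ζ - 1‖ ^ Nat.totient (p ^ n) = (p : ℝ)⁻¹ := by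
  have hp' : p.Prime := hp.out
  have hpn : 0 < p ^ n := pow_pos hp'.pos n
  obtain ⟨k, rfl⟩ := Nat.exists_eq_succ_of_ne_zero hn.ne'
  have hprod : (p : ℂ_[p]) = ∏ μ ∈ primitiveRoots (p ^ (k + 1)) ℂ_[p], (1 - μ) := by
    have h := congrArg (Polynomial.eval (1 : ℂ_[p])) (cyclotomic_eq_prod_X_sub_primitiveRoots hζ)
    rw [eval_one_cyclotomic_prime_pow, eval_prod] at h
    simpa only [eval_sub, eval_X, eval_C] using h
  have hnorm : ‖(p : ℂ_[p])‖ = (p : ℝ)⁻¹ := by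
    rw [← map_natCast (algebraMap ℚ_[p] ℂ_[p]) p]
    exact (PadicComplex.norm_extends' (p := p) (p : ℚ_[p])).trans (Padic.norm_p)
  have hconst : ∀ μ ∈ primitiveRoots (p ^ (k + 1)) ℂ_[p], ‖1 - μ‖ = ‖ζ - 1‖ := by
    intro μ hμ
    rw [mem_primitiveRoots hpn] at hμ
    obtain ⟨j, -, hj, rfl⟩ := (hζ.isPrimitiveRoot_iff).mp hμ
    rw [R1.norm_one_sub_pow_eq hpn hζ hj, norm_sub_rev]
  rw [← hnorm, hprod, norm_prod, Finset.prod_congr rfl hconst, Finset.prod_const, hζ.card_primitiveRoots]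

/-- The norm `r = ‖ζ − 1‖` of a primitive `pⁿ`-th root of unity minus one satisfies `0 < r < 1`. [folklore] -/
theorem norm_sub_one_pos_lt_one_of_isPrimitiveRoot_prime_pow {n : ℕ} (hn : 0 < n) {ζ : ℂ_[p]}
    (hζ : IsPrimitiveRoot ζ (p ^ n)) : 0 < ‖ζ - 1‖ ∧ ‖ζ - 1‖ < 1 := by
  have hp' : p.Prime := hp.out
  have hpR : (1 : ℝ) < p := by exact_mod_cast hp'.one_lt
  have hφ : 0 < Nat.totient (p ^ n) := Nat.totient_pos.mpr (pow_pos hp'.pos n)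
  have hpow := norm_sub_one_pow_totient_of_isPrimitiveRoot_prime_pow hn hζ
  have hinv1 : (p : ℝ)⁻¹ < 1 := inv_lt_one_of_one_lt₀ hpR
  have hinv0 : 0 < (p : ℝ)⁻¹ := inv_pos.mpr (lt_trans zero_lt_one hpR)
  constructor
  · by_contra h
    have h0 : ‖ζ - 1‖ = 0 := le_antisymm (not_lt.mp h) (norm_nonneg _)
    rw [h0, zero_pow hφ.ne'] at hpow
    exact hinv0.ne' hpow.symm |>.elim
  · by_contra h
    have h1 : 1 ≤ ‖ζ - 1‖ := not_lt.mp h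
    have : (1 : ℝ) ≤ ‖ζ - 1‖ ^ Nat.totient (p ^ n) := one_le_pow₀ h1
    rw [hpow] at this
    exact absurd this (not_le.mpr hinv1)

end RootNorm

/-! ## §2 Evaluation with a strictly dominant term (ultrametric) -/

/-- **Dominant term.** If `L ∈ R₀⟦T⟧`, `x ∈ ℂ_p`, `λ ∈ ℕ` and a real `C` satisfy `‖L_i x^i‖ ≤ C < ‖L_λ x^λ‖` for all `i ≠ λ`, then
every value `v` of `L` at `x` has `‖v‖ = ‖L_λ x^λ‖`. [folklore] -/
theorem norm_eq_of_hasValueAt_of_dominant {p : ℕ} [Fact p.Prime] {L : UnrSeries p} {x v : ℂ_[p]}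
    (hv : L.HasValueAt x v) (l : ℕ) {C : ℝ} (hC : 0 ≤ C)
    (hdom : ∀ i : ℕ, i ≠ l → ‖((PowerSeries.coeff i L : unrIntegers p) : ℂ_[p]) * x ^ i‖ ≤ C)
    (hlt : C < ‖((PowerSeries.coeff l L : unrIntegers p) : ℂ_[p]) * x ^ l‖) :
    ‖v‖ = ‖((PowerSeries.coeff l L : unrIntegers p) : ℂ_[p]) * x ^ l‖ := by
  set f : ℕ → ℂ_[p] := fun k ↦ ((PowerSeries.coeff k L : unrIntegers p) : ℂ_[p]) * x ^ k with hf
  have hvf : HasSum f v := hv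
  -- remove the dominant term
  have hδ : HasSum (fun k ↦ if k = l then f l else 0) (f l) := hasSum_ite_eq l (f l)
  have hrest : HasSum (fun k ↦ f k - if k = l then f l else 0) (v - f l) := hvf.sub hδ
  have hbound : ∀ k, ‖f k - if k = l then f l else 0‖ ≤ C := by
    intro k
    by_cases hk : k = l
    · subst hk; simp [hC]
    · rw [if_neg hk, sub_zero]; exact hdom k hk
  have hsmall : ‖v - f l‖ ≤ C := by
    rw [← hrest.tsum_eq]
    exact IsUltrametricDist.norm_tsum_le_of_forall_le_of_nonneg hC hbound
  have hlt' : ‖v - f l‖ < ‖f l‖ := lt_of_le_of_lt hsmall hlt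
  calc ‖v‖ = ‖f l + (v - f l)‖ := by rw [add_sub_cancel]
    _ = ‖f l‖ := IsUltrametricDist.norm_add_eq_max_of_norm_ne_norm (ne_of_gt hlt') ▸ max_eq_left hlt'.le

/-! ## §3 The rigidity statement -/

/-- **`DeepLayerRigidity`, VERBATIM shape** (crux idea `deep-conductor-stability` on stmt-BirchSwinnertonDyer-27120): a series
`H ∈ R₀⟦T⟧` whose values at all deep-conductor points `aζ − 1` (`ζ` primitive of order `3ⁿ`, `n ≥ n₀`, `‖a − 1‖ < 1`) have norm
`≤ ‖3‖` has all its coefficients of norm `< 1`. [folklore] -/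
theorem deepLayerRigidity :
    ∀ (H : UnrSeries 3) (a : ℂ_[3]) (n₀ : ℕ), ‖a - 1‖ < 1 →
      (∀ n : ℕ, n₀ ≤ n → ∀ ζ : ℂ_[3], IsPrimitiveRoot ζ (3 ^ n) →
        ∃ v : ℂ_[3], H.HasValueAt (a * ζ - 1) v ∧ ‖v‖ ≤ ‖(3 : ℂ_[3])‖) →
      ∀ i : ℕ, ‖((PowerSeries.coeff i H : unrIntegers 3) : ℂ_[3])‖ < 1 := by
  intro H a n₀ ha hval
  by_contra hnot
  push Not at hnot
  -- the first unit coefficient `l`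
  have hex : ∃ i : ℕ, ‖((PowerSeries.coeff i H : unrIntegers 3) : ℂ_[3])‖ = 1 := by
    obtain ⟨i, hi⟩ := hnot
    exact ⟨i, le_antisymm (Halves.norm_coe_unrIntegers_le_one 3 _) hi⟩
  let l := Nat.find hex
  have hl : ‖((PowerSeries.coeff l H : unrIntegers 3) : ℂ_[3])‖ = 1 := Nat.find_spec hex
  have hlow : ∀ i < l, ‖((PowerSeries.coeff i H : unrIntegers 3) : ℂ_[3])‖ ≤ (3 : ℝ)⁻¹ := by
    intro i hi
    have hne : ‖((PowerSeries.coeff i H : unrIntegers 3) : ℂ_[3])‖ ≠ 1 := Nat.find_min hex hi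
    have hlt : ‖((PowerSeries.coeff i H : unrIntegers 3) : ℂ_[3])‖ < 1 :=
      lt_of_le_of_ne (Halves.norm_coe_unrIntegers_le_one 3 _) hne
    exact_mod_cast R1.norm_le_inv_of_norm_lt_one (PowerSeries.coeff i H).2 hlt
  -- `‖a‖ = 1`
  have ha1 : ‖a‖ = 1 := by
    have h := IsUltrametricDist.norm_add_eq_max_of_norm_ne_norm (x := a - 1) (y := (1 : ℂ_[3]))
      (by rw [norm_one]; exact ne_of_lt ha)
    rw [sub_add_cancel, norm_one, max_eq_right ha.le] at h
    exact h
  -- an exponent `m` with `‖a − 1‖^m < 1/3`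
  obtain ⟨m, hm⟩ := exists_pow_lt_of_lt_one (show (0 : ℝ) < 3⁻¹ by norm_num) ha
  -- choose the layer `n`
  set n : ℕ := max n₀ (max l m) + 1 with hn
  have hn₀ : n₀ ≤ n := by omega
  have hn1 : 0 < n := by omega
  have hφ : Nat.totient (3 ^ n) = 2 * 3 ^ (n - 1) := by
    rw [Nat.totient_prime_pow Nat.prime_three hn1]; ring
  have h3pow : n - 1 < 3 ^ (n - 1) := Nat.lt_pow_self (by norm_num)
  have hlφ : l < Nat.totient (3 ^ n) := by rw [hφ]; omega
  have hmφ : m < Nat.totient (3 ^ n) := by rw [hφ]; omega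
  -- a primitive `3ⁿ`-th root of unity in `ℂ_3`
  haveI : NeZero ((3 : ℕ) : ℂ_[3]) := ⟨by exact_mod_cast (show (3 : ℕ) ≠ 0 by norm_num)⟩
  obtain ⟨ζ, hζ⟩ := HasEnoughRootsOfUnity.prim (M := ℂ_[3]) (n := 3 ^ n)
  obtain ⟨hr0, hr1⟩ := norm_sub_one_pos_lt_one_of_isPrimitiveRoot_prime_pow hn1 hζ
  have hrφ : ‖ζ - 1‖ ^ Nat.totient (3 ^ n) = (3 : ℝ)⁻¹ := by
    exact_mod_cast norm_sub_one_pow_totient_of_isPrimitiveRoot_prime_pow hn1 hζ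
  set r : ℝ := ‖ζ - 1‖ with hrdef
  -- `r > ‖a − 1‖` and `r^l > 1/3`
  have hra : ‖a - 1‖ < r := by
    by_contra h
    have h' : r ≤ ‖a - 1‖ := not_lt.mp h
    have h1 : r ^ m ≤ ‖a - 1‖ ^ m := pow_le_pow_left₀ hr0.le h' m
    have h2 : r ^ Nat.totient (3 ^ n) < r ^ m := pow_lt_pow_right_of_lt_one₀ hr0 hr1 hmφ
    rw [hrφ] at h2
    linarith
  have hrl : (3 : ℝ)⁻¹ < r ^ l := by
    rw [← hrφ]
    exact pow_lt_pow_right_of_lt_one₀ hr0 hr1 hlφ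
  -- the point `x = aζ − 1` has norm `r`
  set x : ℂ_[3] := a * ζ - 1 with hxdef
  have hx : ‖x‖ = r := by
    have hsplit : x = a * (ζ - 1) + (a - 1) := by rw [hxdef]; ring
    have hne : ‖a * (ζ - 1)‖ ≠ ‖a - 1‖ := by
      rw [norm_mul, ha1, one_mul]; exact (ne_of_lt hra).symm
    rw [hsplit, IsUltrametricDist.norm_add_eq_max_of_norm_ne_norm hne, norm_mul, ha1, one_mul]
    exact max_eq_left hra.le
  -- the value at `x`
  obtain ⟨v, hv, hv3⟩ := hval n hn₀ ζ hζ
  have h3 : ‖(3 : ℂ_[3])‖ = (3 : ℝ)⁻¹ := by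
    have := Literature.NumberTheory.LFunctions.Dwork.norm_natCast_p_padicComplex (p := 3)
    exact_mod_cast this
  -- dominance bound `C = max (1/3) (r^(l+1))`
  have hC0 : (0 : ℝ) ≤ max 3⁻¹ (r ^ (l + 1)) := le_max_of_le_left (by norm_num)
  have hdom : ∀ i : ℕ, i ≠ l →
      ‖((PowerSeries.coeff i H : unrIntegers 3) : ℂ_[3]) * x ^ i‖ ≤ max 3⁻¹ (r ^ (l + 1)) := by
    intro i hi
    rw [norm_mul, norm_pow, hx]
    rcases Nat.lt_or_gt_of_ne hi with hil | hil
    · -- `i < l`: coefficient `≤ 1/3`, `r^i ≤ 1`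
      refine le_max_of_le_left ?_
      calc ‖((PowerSeries.coeff i H : unrIntegers 3) : ℂ_[3])‖ * r ^ i ≤ 3⁻¹ * 1 :=
            mul_le_mul (hlow i hil) (pow_le_one₀ hr0.le hr1.le) (pow_nonneg hr0.le i) (by norm_num)
        _ = 3⁻¹ := mul_one _
    · -- `i > l`: coefficient `≤ 1`, `r^i ≤ r^(l+1)`
      refine le_max_of_le_right ?_
      calc ‖((PowerSeries.coeff i H : unrIntegers 3) : ℂ_[3])‖ * r ^ i ≤ 1 * r ^ (l + 1) :=
            mul_le_mul (Halves.norm_coe_unrIntegers_le_one 3 _) (pow_le_pow_of_le_one hr0.le hr1.le (Nat.succ_le_of_lt hil))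
              (pow_nonneg hr0.le i) zero_le_one
        _ = r ^ (l + 1) := one_mul _
  have hlt : max 3⁻¹ (r ^ (l + 1)) < ‖((PowerSeries.coeff l H : unrIntegers 3) : ℂ_[3]) * x ^ l‖ := by
    rw [norm_mul, norm_pow, hx, hl, one_mul]
    exact max_lt hrl (pow_lt_pow_right_of_lt_one₀ hr0 hr1 (Nat.lt_succ_self l))
  have hnormv := norm_eq_of_hasValueAt_of_dominant hv l hC0 hdom hlt
  rw [norm_mul, norm_pow, hx, hl, one_mul] at hnormv
  rw [hnormv, h3] at hv3
  exact absurd hv3 (not_le.mpr hrl)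

end Summit.BirchSwinnertonDyer.BirchSwinnertonDyer.Theorems.UniversalToricDescentDeepLayerRigidity

end
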